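import Literature.NumberTheory.QuadraticFields.BinaryQuadraticFormsClassNumberCount
import HarnessLib

/-!
# Row chunks for the class-number pair counter (splitting one kernel evaluation into several)

Topic `NumberTheory/QuadraticFields`, namespace `Literature.NumberTheory.QuadraticFields.Quadratic` (sub-namespace `BinQF`);
a small companion of `BinaryQuadraticFormsClassNumberCount.lean`. There `BinQF.classNumberCount N = redRowsSum N ⌊√(N/3)⌋`
sums the rows `a = 1, …, ⌊√(N/3)⌋` of Cohen's Algorithm 5.3.5 in ONE structural recursion, and
`BinQF.classNumber_eq_classNumberCount` turns it into `h(−N)`. A single `decide +kernel` evaluation is bounded by the kernel's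
share of the heartbeat budget (≈ 1.2·10⁷ pair tests, i.e. `N ≈ 1.4·10⁷`, in practice); for larger `|D|` the row range is cut into
CHUNKS, each evaluated in its own declaration, and the pieces are added:

* `BinQF.redRowsSumFrom N k₀ k` — the sum of the rows `k₀ + 1, …, k₀ + k` (computable, structural recursion);
* `redRowsSum_add` (`redRowsSum N (k₀ + k) = redRowsSum N k₀ + redRowsSumFrom N k₀ k`), `redRowsSum_eq_redRowsSumFrom`,
  **`redRowsSumFrom_add`** (`redRowsSumFrom N k₀ (k + k') = redRowsSumFrom N k₀ k + redRowsSumFrom N (k₀ + k) k'`) and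
  **`classNumberCount_eq_redRowsSumFrom`** (`classNumberCount N = redRowsSumFrom N 0 (countBound N)`), so that
  `classNumberCount N = c₁ + ⋯ + c_m` follows from `m` separately certified chunk values by rewriting.

First consumer: `ImaginaryQuadraticClassNumbersDeep*.lean` (the landau-siegel rescue bed's ladder rungs `|D| ≥ 2·10⁷`).

## References

* [Cohen1993] H. Cohen, *A Course in Computational Algebraic Number Theory*, GTM 138 (1993), §5.3.1, Algorithm 5.3.5.
-/

namespace Literature.NumberTheory.QuadraticFields.Quadratic

namespace BinQF

/-- The sum of the rows `a = k₀ + 1, …, k₀ + k` of the pair counter (`redRowSum N a (redRowLen N a)` each).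
[cite: Cohen1993, §5.3.1 Algorithm 5.3.5] -/
def redRowsSumFrom (N k₀ : ℕ) : ℕ → ℕ
  | 0 => 0
  | k + 1 => redRowsSumFrom N k₀ k + redRowSum N (k₀ + k + 1) (redRowLen N (k₀ + k + 1))

/-- Splitting off a tail chunk: `redRowsSum N (k₀ + k) = redRowsSum N k₀ + redRowsSumFrom N k₀ k`.
[cite: Cohen1993, §5.3.1 Algorithm 5.3.5] -/
theorem redRowsSum_add (N k₀ k : ℕ) : redRowsSum N (k₀ + k) = redRowsSum N k₀ + redRowsSumFrom N k₀ k := by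
  induction k with
  | zero => simp [redRowsSumFrom]
  | succ k ih =>
    rw [← Nat.add_assoc, redRowsSum, ih, redRowsSumFrom, Nat.add_assoc]

/-- The whole range is the chunk from `0`: `redRowsSum N k = redRowsSumFrom N 0 k`. [cite: Cohen1993, §5.3.1 Algorithm 5.3.5] -/
theorem redRowsSum_eq_redRowsSumFrom (N k : ℕ) : redRowsSum N k = redRowsSumFrom N 0 k := by
  have h := redRowsSum_add N 0 k
  rw [Nat.zero_add] at h
  rw [h, redRowsSum]
  exact Nat.zero_add _

/-- **Chunk additivity**: `redRowsSumFrom N k₀ (k + k') = redRowsSumFrom N k₀ k + redRowsSumFrom N (k₀ + k) k'`.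
[cite: Cohen1993, §5.3.1 Algorithm 5.3.5] -/
theorem redRowsSumFrom_add (N k₀ k k' : ℕ) :
    redRowsSumFrom N k₀ (k + k') = redRowsSumFrom N k₀ k + redRowsSumFrom N (k₀ + k) k' := by
  induction k' with
  | zero => simp [redRowsSumFrom]
  | succ k' ih =>
    rw [← Nat.add_assoc, redRowsSumFrom, ih, redRowsSumFrom, Nat.add_assoc, Nat.add_assoc k₀ k k']

/-- **The counter as one chunk**: `classNumberCount N = redRowsSumFrom N 0 ⌊√(N/3)⌋` — the starting point for splitting a
kernel evaluation of `h(−N)` into several declarations with `redRowsSumFrom_add`. [cite: Cohen1993, §5.3.1 Algorithm 5.3.5] -/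
theorem classNumberCount_eq_redRowsSumFrom (N : ℕ) : classNumberCount N = redRowsSumFrom N 0 (countBound N) := by
  rw [classNumberCount, redRowsSum_eq_redRowsSumFrom]

/-- Regression: the two-chunk split of the `N = 77 683` evaluation (`countBound 77683 = 160 = 100 + 60`) reproduces `h(−77683) = 22`
(`classNumberCount_examples`). [cite: Cohen1993, §5.3.1 Algorithm 5.3.5] -/
theorem classNumberCount_77683_by_chunks :
    redRowsSumFrom 77683 0 100 = 9 ∧ redRowsSumFrom 77683 100 60 = 13 ∧ classNumberCount 77683 = 22 := by
  refine ⟨by decide +kernel, by decide +kernel, ?_⟩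
  rw [classNumberCount_eq_redRowsSumFrom, show countBound 77683 = 100 + 60 by decide +kernel, redRowsSumFrom_add]
  decide +kernel

end BinQF

end Literature.NumberTheory.QuadraticFields.Quadratic
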